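import Summits.BirchSwinnertonDyer.BirchSwinnertonDyer.Theorems.GoldfeldGoodTwistsFormula
import Literature.NumberTheory.EllipticCurves.BSDSelmerSmithCMTableProofs
import Literature.NumberTheory.EllipticCurves.IsogenyHasCMIffJMemProofs
import HarnessLib

/-!
# The even half of Goldfeld's conjecture, with BSD, for every CM elliptic curve over `ℚ` with `j ≠ 8000`

Cell `bsd-goldfeld` (planner seat, generation 4), file 11. Theorems only — no named fact, no
axiom, no definition. File 7 (`GoldfeldGoodTwistsPublishedInputs`) proves, for an elliptic CM curve
`W / ℚ` satisfying Smith's distribution statement `hS : smith_selmerCorank_density W`, that among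
ALL squarefree `d` (both signs, ordered by `|d|`, the tree's `twistDensity`) the set of `d` with
`ord_{s=1} L(W^{(d)}, s) = 0`, `rank W^{(d)}(ℚ) = 0` and `Ш(W^{(d)}/ℚ)` finite has natural density
EXACTLY `1/2` (`twistDensity_rankZero_bsd_of_hasCM`, inputs Burungale–Tian `hBT` and
Gross–Zagier–Kolyvagin `hGZK`), and instantiates it for the two `ℚ(√−7)` classes. The Literature
seats of the cell have meanwhile certified Smith's statement from the REFEREED [Smi22a] Thm. 1.2
(`h22 : smith2022_selmerCorank_distribution`, J. Amer. Math. Soc. 39 (2026)) for every CM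
`j`-invariant except `8000` — `BSDSelmerSmithCMTableProofs` (`j = 0, 1728, 54000, 287496`),
`BSDSelmerSmithNoRationalTwoTorsionCMProofs` (`j = −32768, −884736, −884736000, −147197952000,
−262537412640768000, −12288000`), file 6 `GoldfeldGoodTwistsSmithCaseII` (`j = −3375, 16581375`);
for `j = 8000` (`y² = x³ + 4dx² + 2d²x`, CM by `ℤ[√−2]`) [Smi22a]'s Assumption 1.1 FAILS
(`not_smi22aAssumption_of_j_eq_8000`: a balanced `2`-isogeny), and Smith's law is only available
from the preprint assembly `smith_selmerCorank_density_holds_of` (arXiv:2503.17619 Thm. 1.17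
Cases IV/V, Monsky, Modularity).

This file dispatches on the CM `j`-table (`WeierstrassCurve.hasCM_iff_j_mem_holds`: `HasCM W ↔
j(W) ∈` the thirteen values `WeierstrassCurve.cmJInvariants`, a tree THEOREM) and records:

* `smith_selmerCorank_density_of_hasCM_of_j_ne_8000` — Smith's `2^∞`-Selmer corank law
  (`1/2, 1/2, 0`) for EVERY elliptic `W / ℚ` with CM and `j(W) ≠ 8000`, from `h22` alone.
* `goldfeld_rankZero_half_allTwists_of_hasCM` — **the even-parity half of Goldfeld's conjecture,
  with BSD, for every CM elliptic curve over `ℚ` with `j ≠ 8000`**: density exactly `1/2` of the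
  squarefree `d` have `ord_{s=1} L(W^{(d)}, s) = rank W^{(d)}(ℚ) = 0` and `Ш(W^{(d)}/ℚ)` finite;
  hypotheses `{h22, hBT, hGZK}`, all refereed print ([Smi22a]; Burungale–Tian, Ann. of Math. 203
  (2026), Thm. 1.1; Gross–Zagier, Kolyvagin). Also: the complementary half; the analytic-rank-only
  form with Monsky's `2`-parity in place of GZK (the Literature theorem
  `twistDensity_analyticRank_eq_zero_of_hasCM_of_burungaleTian`, now unconditional in `hS`); the
  Cor.-1.3 shape "`100 %` of the twists with `w(W^{(d)}) = +1` have `ord L = rank = 0`, `Ш` finite";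
  the FULL BSD conjecture (`BSDTriple` and `BSD(E, p)` for every prime `p`, for the minimal models)
  for the same `50 %` via file 8's `twistDensity_rankZero_bsdTriple_of_hasCM` (adds Rubin /
  Burungale–Flach `hBF` and `hasEntireLFunction_rat`); and the all-thirteen version from the
  preprint inputs.

Print status. Burungale–Tian state the even-parity Goldfeld conjecture for the congruent number
curve (Ann. of Math. 203 (2026), abstract and Thm. 1.2: "the first instance of the even parity
Goldfeld conjecture"), with Smith's J. Amer. Math. Soc. theorem for that family; Smith
(arXiv:2503.17619, Cor. 1.2–1.3) derives Goldfeld for general `E` CONDITIONALLY on BSD. The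
statement for all CM curves with `j ≠ 8000` is the conjunction of [Smi22a] Thm. 1.2 (with
Assumption 1.1 verified class by class — the tree's `j`-table files above), Burungale–Tian Thm. 1.1
(any CM curve, `p = 2` allowed, no reduction hypothesis at `p`) and GZK; the cell's literature
seats found no printed statement of it beyond `j = 1728` (searches recorded in the cell's
`HYPOTHESIS-TABLE.md`; planner presearch 2026-08-25: corpus fts+vec and galaxy null for
"even parity Goldfeld" / "Goldfeld conjecture for CM").

References: A. Smith, J. Amer. Math. Soc. 39 (2026), Thm. 1.2 [Smith2022SelmerTwistI]; A. Smith,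
arXiv:2503.17619, Thm. 1.1, Cor. 1.2–1.3, Thm. 1.17 [arXiv250317619]; A. Burungale, Y. Tian, Ann. of
Math. 203 (2026), Thm. 1.1–1.2 [BurungaleTian2026]; T. Dokchitser, V. Dokchitser, Ann. of Math. 172
(2010) [DokchitserDokchitserAnnals2010]; J. H. Silverman, *AEC*, App. C §11 [SilvermanAEC2009];
K. Rubin, Invent. Math. 103 (1991); A. Burungale, M. Flach, Camb. J. Math. 12 (2024) [BurungaleFlach2024].
-/

set_option linter.dupNamespace false
set_option autoImplicit false

noncomputable section

open scoped Classical

open Filter Topology WeierstrassCurve Literature.NumberTheory.EllipticCurves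
  Literature.NumberTheory.EllipticCurves.BurungaleCastellaSkinnerTian2022
  Literature.NumberTheory.EllipticCurves.ModularForms

namespace Summit.BirchSwinnertonDyer.BirchSwinnertonDyer.Theorems.GoldfeldGoodTwists

/-! ## §1 Smith's corank law for every CM curve with `j ≠ 8000`, from [Smi22a] -/

/-- **Smith's `2^∞`-Selmer corank law for every CM elliptic curve over `ℚ` with `j ≠ 8000`, from
the refereed [Smi22a] Thm. 1.2.** For `W / ℚ` elliptic with complex multiplication and
`j(W) ≠ 8000`: `corank_{ℤ_2} Sel_{2^∞}(W^{(d)}/ℚ) = 0` for density `1/2` of the squarefree `d`,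
`= 1` for density `1/2`, `≥ 2` for density `0` (`smith_selmerCorank_density W`). Proof: `j(W)` is
one of the thirteen CM `j`-invariants (`hasCM_iff_j_mem_holds`); twelve of them are covered by the
tree's per-class verifications of [Smi22a]'s Assumption 1.1 (Case I / Case II / no rational
`2`-torsion / the `2`-isogeny transport), the thirteenth is `8000`.
[cite: Smith2022SelmerTwistI, Thm. 1.2 and Assumption 1.1] [cite: SilvermanAEC2009, App. C §11] -/
theorem smith_selmerCorank_density_of_hasCM_of_j_ne_8000
    (h22 : smith2022_selmerCorank_distribution) (W : WeierstrassCurve ℚ) [W.IsElliptic]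
    (hCM : W.HasCM) (hj : W.j ≠ 8000) : smith_selmerCorank_density W := by
  have hmem : W.j ∈ cmJInvariants := (WeierstrassCurve.hasCM_iff_j_mem_holds W).1 hCM
  simp only [cmJInvariants, Finset.mem_insert, Finset.mem_singleton] at hmem
  rcases hmem with h | h | h | h | h | h | h | h | h | h | h | h | h
  · exact smith_selmerCorank_density_of_j_eq_zero_of_smith2022 h22 W h
  · exact smith_selmerCorank_density_of_j_eq_1728_of_smith2022 h22 W h
  · exact smith_selmerCorank_density_of_j_eq_neg3375 h22 W h
  · exact absurd h hj
  · exact smith_selmerCorank_density_of_j_mem_of_smith2022 h22 W (Or.inl h)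
  · exact smith_selmerCorank_density_of_j_eq_54000_of_smith2022 h22 W h
  · exact smith_selmerCorank_density_of_j_eq_287496_of_smith2022 h22 W h
  · exact smith_selmerCorank_density_of_j_mem_of_smith2022 h22 W (Or.inr (Or.inl h))
  · exact smith_selmerCorank_density_of_j_eq_neg12288000_of_smith2022 h22 W h
  · exact smith_selmerCorank_density_of_j_eq_16581375 h22 W h
  · exact smith_selmerCorank_density_of_j_mem_of_smith2022 h22 W (Or.inr (Or.inr (Or.inl h)))
  · exact smith_selmerCorank_density_of_j_mem_of_smith2022 h22 W
      (Or.inr (Or.inr (Or.inr (Or.inl h))))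
  · exact smith_selmerCorank_density_of_j_mem_of_smith2022 h22 W
      (Or.inr (Or.inr (Or.inr (Or.inr h))))

/-- Smith's corank law for EVERY CM elliptic curve over `ℚ` (all thirteen classes, `j = 8000`
included) from the preprint-level inputs: [Smi22a] Thm. 1.2 (`h22`), arXiv:2503.17619 Thm. 1.17
Cases IV/V (`h17IV`, `h17V`), Monsky's `2`-parity (`hMon`) and Modularity (`hmod`) — the
Literature assembly `smith_selmerCorank_density_holds_of`, which in fact needs no CM hypothesis.
[cite: arXiv250317619, Thm. 1.1 and Thm. 1.17] [cite: Smith2022SelmerTwistI, Thm. 1.2] -/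
theorem smith_selmerCorank_density_of_hasCM_of_smith_inputs (hmod : exists_isNewformOf)
    (hMon : monsky_selmerCorank_two_mod_two_eq) (h22 : smith2022_selmerCorank_distribution)
    (h17IV : smith2025_thm117_caseIV) (h17V : smith2025_thm117_caseV)
    (W : WeierstrassCurve ℚ) [W.IsElliptic] : smith_selmerCorank_density W :=
  smith_selmerCorank_density_holds_of hmod hMon h22 h17IV h17V W

/-! ## §2 The even half of Goldfeld, with BSD, for every CM curve with `j ≠ 8000` -/

/-- **The even-parity half of Goldfeld's conjecture, with BSD, for every CM elliptic curve over
`ℚ` with `j ≠ 8000`.** Let `W / ℚ` be an elliptic curve with complex multiplication,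
`j(W) ≠ 8000`. Assume [Smi22a] Thm. 1.2 (`h22`), Burungale–Tian's rank-zero `p`-converse for CM
curves (`hBT`, used at `p = 2`; no hypothesis on the reduction at `2`) and Gross–Zagier–Kolyvagin
(`hGZK`) — the tree's named facts, all refereed print. Then among ALL squarefree `d` (both signs,
ordered by `|d|`) the set of `d` with `ord_{s=1} L(W^{(d)}, s) = 0`, `rank W^{(d)}(ℚ) = 0` and
`Ш(W^{(d)}/ℚ)` finite has natural density EXACTLY `1/2`.
[cite: Smith2022SelmerTwistI, Thm. 1.2] [cite: BurungaleTian2026, Thm. 1.1 and Thm. 1.2]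
[cite: arXiv250317619, Cor. 1.2 (shape)] -/
theorem goldfeld_rankZero_half_allTwists_of_hasCM (h22 : smith2022_selmerCorank_distribution)
    (hBT : burungaleTian_analyticRank_eq_zero_of_selmerCorank_eq_zero_of_hasCM)
    (hGZK : rank_eq_analyticRank_of_analyticRank_le_one)
    (W : WeierstrassCurve ℚ) [W.IsElliptic] (hCM : W.HasCM) (hj : W.j ≠ 8000) :
    twistDensity (fun d ↦ (W.quadraticTwist d).analyticRank = 0 ∧
      (W.quadraticTwist d).mordellWeilRank = 0 ∧ Finite (W.quadraticTwist d).sha) (1 / 2) :=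
  twistDensity_rankZero_bsd_of_hasCM hBT hGZK W hCM
    (smith_selmerCorank_density_of_hasCM_of_j_ne_8000 h22 W hCM hj)

/-- The same, unfolded: `#{d squarefree, |d| ≤ X : ord_{s=1} L(W^{(d)}, s) = rank W^{(d)}(ℚ) = 0,
Ш(W^{(d)}/ℚ) finite} / #{d squarefree, |d| ≤ X} → 1/2`. [cite: Smith2022SelmerTwistI, Thm. 1.2]
[cite: BurungaleTian2026, Thm. 1.1] -/
theorem tendsto_rankZero_half_allTwists_of_hasCM (h22 : smith2022_selmerCorank_distribution)
    (hBT : burungaleTian_analyticRank_eq_zero_of_selmerCorank_eq_zero_of_hasCM)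
    (hGZK : rank_eq_analyticRank_of_analyticRank_le_one)
    (W : WeierstrassCurve ℚ) [W.IsElliptic] (hCM : W.HasCM) (hj : W.j ≠ 8000) :
    Tendsto (fun X : ℕ ↦ (Nat.card {d : ℤ | Squarefree d ∧ |d| ≤ (X : ℤ) ∧
        ((W.quadraticTwist d).analyticRank = 0 ∧ (W.quadraticTwist d).mordellWeilRank = 0 ∧
          Finite (W.quadraticTwist d).sha)} : ℝ) /
      Nat.card {d : ℤ | Squarefree d ∧ |d| ≤ (X : ℤ)}) atTop (𝓝 (1 / 2)) :=
  goldfeld_rankZero_half_allTwists_of_hasCM h22 hBT hGZK W hCM hj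

/-- The complementary half: the squarefree `d` for which NOT (`ord_{s=1} L(W^{(d)}, s) = 0 ∧ rank
W^{(d)}(ℚ) = 0 ∧ Ш` finite) also have density exactly `1/2` (up to density `0` these are the
corank-one twists). [cite: Smith2022SelmerTwistI, Thm. 1.2] [cite: BurungaleTian2026, Thm. 1.1] -/
theorem goldfeld_not_rankZero_half_allTwists_of_hasCM (h22 : smith2022_selmerCorank_distribution)
    (hBT : burungaleTian_analyticRank_eq_zero_of_selmerCorank_eq_zero_of_hasCM)
    (hGZK : rank_eq_analyticRank_of_analyticRank_le_one)
    (W : WeierstrassCurve ℚ) [W.IsElliptic] (hCM : W.HasCM) (hj : W.j ≠ 8000) :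
    twistDensity (fun d ↦ ¬ ((W.quadraticTwist d).analyticRank = 0 ∧
      (W.quadraticTwist d).mordellWeilRank = 0 ∧ Finite (W.quadraticTwist d).sha)) (1 / 2) :=
  twistDensity_not_rankZero_bsd_of_hasCM hBT hGZK W hCM
    (smith_selmerCorank_density_of_hasCM_of_j_ne_8000 h22 W hCM hj)

/-- **Even-parity Goldfeld, analytic-rank-only form, for every CM curve with `j ≠ 8000`**
(Burungale–Tian's Thm. 1.2 shape): `ord_{s=1} L(W^{(d)}, s) = 0` for density exactly `1/2` of
the squarefree `d`, from `h22`, `hBT` and Monsky's `2`-parity (`hMon`, for the direction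
`ord L = 0 ⟹ corank even ⟹ 0` on Smith's density-one set) — the Literature theorem
`twistDensity_analyticRank_eq_zero_of_hasCM_of_burungaleTian` with its Smith hypothesis
discharged. [cite: BurungaleTian2026, abstract and Thm. 1.2] [cite: Smith2022SelmerTwistI, Thm. 1.2] -/
theorem evenGoldfeld_analyticRank_allTwists_of_hasCM (h22 : smith2022_selmerCorank_distribution)
    (hBT : burungaleTian_analyticRank_eq_zero_of_selmerCorank_eq_zero_of_hasCM)
    (hMon : monsky_selmerCorank_two_mod_two_eq)
    (W : WeierstrassCurve ℚ) [W.IsElliptic] (hCM : W.HasCM) (hj : W.j ≠ 8000) :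
    twistDensity (fun d ↦ d ≠ 0 ∧ (W.quadraticTwist d).analyticRank = 0) (1 / 2) :=
  twistDensity_analyticRank_eq_zero_of_hasCM_of_burungaleTian hBT hMon W hCM
    (smith_selmerCorank_density_of_hasCM_of_j_ne_8000 h22 W hCM hj)

/-- **Cor. 1.3 shape: `100 %` of the even-parity twists of a CM curve with `j ≠ 8000` have
`ord_{s=1} L = rank = 0` and finite `Ш`.** The squarefree `d` with "`w(W^{(d)}) = +1 ⟹
ord_{s=1} L(W^{(d)}, s) = 0 ∧ rank W^{(d)}(ℚ) = 0 ∧ Ш(W^{(d)}/ℚ)` finite" have density `1`;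
`2`-parity from Monsky (`hMon`) and Modularity (`hmod`). [cite: arXiv250317619, Cor. 1.3]
[cite: Smith2022SelmerTwistI, Thm. 1.2] [cite: BurungaleTian2026, Thm. 1.1]
[cite: DokchitserDokchitserAnnals2010, §4.6 (case p = 2)] -/
theorem rankZero_bsd_of_rootNumber_eq_one_allTwists_of_hasCM
    (h22 : smith2022_selmerCorank_distribution)
    (hBT : burungaleTian_analyticRank_eq_zero_of_selmerCorank_eq_zero_of_hasCM)
    (hGZK : rank_eq_analyticRank_of_analyticRank_le_one) (hmod : exists_isNewformOf)
    (hMon : monsky_selmerCorank_two_mod_two_eq)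
    (W : WeierstrassCurve ℚ) [W.IsElliptic] (hCM : W.HasCM) (hj : W.j ≠ 8000) :
    twistDensity (fun d ↦ d ≠ 0 → (W.quadraticTwist d).rootNumber = 1 →
      ((W.quadraticTwist d).analyticRank = 0 ∧ (W.quadraticTwist d).mordellWeilRank = 0 ∧
        Finite (W.quadraticTwist d).sha)) 1 :=
  twistDensity_rankZero_bsd_of_rootNumber_eq_one_of_hasCM_of_exists_isNewformOf hBT hGZK hmod hMon
    W hCM (smith_selmerCorank_density_of_hasCM_of_j_ne_8000 h22 W hCM hj)

/-- **Full BSD for `50 %` of the quadratic twists of every CM curve with `j ≠ 8000`.** Adding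
Rubin / Burungale–Flach (`hBF`: the full BSD formula for CM curves with `L(E, 1) ≠ 0`) and the
holomorphy of `L(E, s)` (`hmod`): among all squarefree `d`, density exactly `1/2` of them have
`ord_{s=1} L(W^{(d)}, s) = rank W^{(d)}(ℚ) = 0`, `Ш(W^{(d)}/ℚ)` finite AND the full
Birch–Swinnerton-Dyer conjecture (`BSDTriple`, and `BSD(E, p)` for every prime `p`) for every
globally minimal model of `W^{(d)}` — file 8's `twistDensity_rankZero_bsdTriple_of_hasCM` with its
Smith hypothesis discharged. [cite: Smith2022SelmerTwistI, Thm. 1.2] [cite: BurungaleTian2026, Thm. 1.1]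
[cite: BurungaleFlach2024, Thm. 1.1] -/
theorem fullBSD_rankZero_half_allTwists_of_hasCM (h22 : smith2022_selmerCorank_distribution)
    (hBT : burungaleTian_analyticRank_eq_zero_of_selmerCorank_eq_zero_of_hasCM)
    (hBF : bsdTriple_of_hasCM_of_L_one_ne_zero) (hmod : hasEntireLFunction_rat)
    (W : WeierstrassCurve ℚ) [W.IsElliptic] (hCM : W.HasCM) (hj : W.j ≠ 8000) :
    twistDensity (fun d ↦ (W.quadraticTwist d).analyticRank = 0 ∧
      (W.quadraticTwist d).mordellWeilRank = 0 ∧ Finite (W.quadraticTwist d).sha ∧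
      ∀ (W' : WeierstrassCurve ℚ) [W'.IsElliptic] [W'.IsGloballyMinimal] (C : VariableChange ℚ),
        C • W' = W.quadraticTwist d → W'.BSDTriple ∧ ∀ p : ℕ, p.Prime → BSDp W' p) (1 / 2) :=
  twistDensity_rankZero_bsdTriple_of_hasCM hBT hBF hmod W hCM
    (smith_selmerCorank_density_of_hasCM_of_j_ne_8000 h22 W hCM hj)

/-! ## §3 All thirteen classes, from the preprint-level Smith inputs -/

/-- **The even half of Goldfeld, with BSD, for EVERY CM elliptic curve over `ℚ`** (`j = 8000`
included), with Smith's law taken from the preprint assembly (`hmod`, `hMon`, `h22`, `h17IV`,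
`h17V`; see `smith_selmerCorank_density_of_hasCM_of_smith_inputs`) and `hBT`, `hGZK` as before.
[cite: arXiv250317619, Thm. 1.1, Thm. 1.17 and Cor. 1.2] [cite: BurungaleTian2026, Thm. 1.1] -/
theorem goldfeld_rankZero_half_allTwists_of_hasCM_of_smith_inputs (hmod : exists_isNewformOf)
    (hMon : monsky_selmerCorank_two_mod_two_eq) (h22 : smith2022_selmerCorank_distribution)
    (h17IV : smith2025_thm117_caseIV) (h17V : smith2025_thm117_caseV)
    (hBT : burungaleTian_analyticRank_eq_zero_of_selmerCorank_eq_zero_of_hasCM)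
    (hGZK : rank_eq_analyticRank_of_analyticRank_le_one)
    (W : WeierstrassCurve ℚ) [W.IsElliptic] (hCM : W.HasCM) :
    twistDensity (fun d ↦ (W.quadraticTwist d).analyticRank = 0 ∧
      (W.quadraticTwist d).mordellWeilRank = 0 ∧ Finite (W.quadraticTwist d).sha) (1 / 2) :=
  twistDensity_rankZero_bsd_of_hasCM hBT hGZK W hCM
    (smith_selmerCorank_density_holds_of hmod hMon h22 h17IV h17V W)

end Summit.BirchSwinnertonDyer.BirchSwinnertonDyer.Theorems.GoldfeldGoodTwists

end
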